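import Summits.AtomisticToContinuum.Crystallization.Theorems.ExcessDecayLiouvilleComparisonEnergyFar
import Summits.AtomisticToContinuum.Crystallization.Theorems.ExcessDecayLiouvilleFarFluxData
import Summits.AtomisticToContinuum.Crystallization.Theorems.ExcessDecayLiouvilleDirichletSolve
import Summits.AtomisticToContinuum.Crystallization.Theorems.ExcessDecayLiouvillePoincare
import Summits.AtomisticToContinuum.Crystallization.Theorems.ExcessDecayLiouvilleNonlinearCaccioppoliStep

/-!
# Route `ExcessDecayLiouville`: the harmonic replacement of one step (nonlinear half, XIII)

Harmonic-replacement architecture for item `ExcessDecay` (stmt-AtomisticToContinuum-9334), nonlinear half.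
Abstract form of the comparison step: a finitely supported field `v` whose rows on the sites of
`B_{ρ'+10L+20}(c₀)` (all in `SR`) are `φ p + Σ_{q ∈ SR∖p} Φ p q` with `Φ` antisymmetric and
`‖Φ p q‖ ≤ Λ (dist p q)⁻⁸ ‖ṽ p − ṽ q‖`, `ṽ = v` on that ball.  The Dirichlet correction `w` on the sites `F` of
`B_{ρ'}(c₀)` (`L(v + w) = 0` on `F`, `exists_dirichlet_correction`) has rows `−φ − ΣΦ` on `F`; its energy is
bounded by `nnForm_correction_le'` with the far flux data of `far_flux_sq_le`, its mass by the Poincaré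
inequality (`step_compare`).  The corrected field `h = v + w` has ZERO rows on `F` — the input of `linear_decay`.
All `[folklore]`; helper lemmas, nothing here closes an item.
-/

noncomputable section

namespace Summit.AtomisticToContinuum.Crystallization.Theorems.ExcessDecayLiouville

open scoped BigOperators Topology InnerProductSpace RealInnerProductSpace Classical
open Literature.MathematicalPhysics.StatisticalMechanics
open Summit.AtomisticToContinuum.Crystallization.Theorems.PhononStabilityNegative

-- Local notation: the force-constant map `K(e)w = h(|e|²)w + 2⟪e,w⟫h′(|e|²)e`.
local notation3 "𝕂[" e "] " w:max =>
  (-((‖e‖ ^ 2)⁻¹) ^ 7 + ((‖e‖ ^ 2)⁻¹) ^ 4) • w + (2 * ⟪e, w⟫ * (7 * ((‖e‖ ^ 2)⁻¹) ^ 8 - 4 * ((‖e‖ ^ 2)⁻¹) ^ 5)) • e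

section

variable {κ : ℝ} {t : Fin 2 → EuclideanSpace ℝ (Fin 3)} {A : EuclideanSpace ℝ (Fin 3) →L[ℝ] EuclideanSpace ℝ (Fin 3)}
  {c₀ : EuclideanSpace ℝ (Fin 3)}

variable (hA : Adm₀ A) (hI : Inner₀ t A)

set_option quotPrecheck false in
-- Local notation: the operator row `(L v)(p)`.
local notation "𝕃" v:max " @ " p:max =>
  tsum (fun q : Sites₀ t A => (if ((p : Sites₀ t A) : EuclideanSpace ℝ (Fin 3)) ≠ q then
    𝕂[((p : Sites₀ t A) : EuclideanSpace ℝ (Fin 3)) - q] (v ((p : Sites₀ t A) : EuclideanSpace ℝ (Fin 3)) - v q) else 0))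
set_option quotPrecheck false in
-- Local notation: the finite near-neighbour form on the ball of radius `X` about `c₀`.
local notation "NN[" v ", " X "]" =>
  (∑ p ∈ (finite_sites_dist_le (t := t) (A := A) hA hI c₀ X).toFinset,
    ∑ q ∈ (finite_sites_dist_le (t := t) (A := A) hA hI c₀ X).toFinset,
      (if p ≠ q ∧ dist p q ≤ 11 / 10 then ‖v p - v q‖ ^ 2 else (0 : ℝ)))

include hA hI in
/-- **The harmonic replacement of one step** (see the module docstring). [folklore] -/
theorem step_compare (hκ0 : 0 < κ)
    (hκ : ∀ v : (EuclideanSpace ℝ (Fin 3)) → (EuclideanSpace ℝ (Fin 3)), (Function.support v).Finite →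
      Function.support v ⊆ Sites₀ t A → κ * nnForm t A v ≤ ∑' p : Sites₀ t A, ⟪𝕃 v @ p, v p⟫)
    (SR : Finset (EuclideanSpace ℝ (Fin 3))) (hSRS : ∀ x ∈ SR, x ∈ Sites₀ t A)
    {ρ' L : ℝ} (hρ' : 1 ≤ ρ') (hL : 1 ≤ L)
    (hSRball : ∀ x ∈ Sites₀ t A, dist x c₀ ≤ ρ' + 10 * L + 20 → x ∈ SR)
    (v vt : (EuclideanSpace ℝ (Fin 3)) → (EuclideanSpace ℝ (Fin 3))) (hv : (Function.support v).Finite)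
    (hvt : ∀ x ∈ Sites₀ t A, dist x c₀ ≤ ρ' + 10 * L + 20 → vt x = v x)
    (φ : (EuclideanSpace ℝ (Fin 3)) → (EuclideanSpace ℝ (Fin 3)))
    (Φ : (EuclideanSpace ℝ (Fin 3)) → (EuclideanSpace ℝ (Fin 3)) → (EuclideanSpace ℝ (Fin 3)))
    (hrow : ∀ p : Sites₀ t A, (p : EuclideanSpace ℝ (Fin 3)) ∈ SR → dist (p : EuclideanSpace ℝ (Fin 3)) c₀ ≤ ρ' + 10 * L + 20 →
      𝕃 v @ p = φ p + ∑ q ∈ SR.erase p, Φ p q)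
    (hanti : ∀ p ∈ SR, ∀ q ∈ SR, Φ q p = -Φ p q) {Λ : ℝ} (hΛ : 0 ≤ Λ)
    (hΦ : ∀ p ∈ SR, ∀ q ∈ SR, p ≠ q → ‖Φ p q‖ ≤ Λ * (dist p q)⁻¹ ^ 8 * ‖vt p - vt q‖) :
    ∃ w : (EuclideanSpace ℝ (Fin 3)) → (EuclideanSpace ℝ (Fin 3)),
      Function.support w ⊆ (finite_sites_dist_le (t := t) (A := A) hA hI c₀ ρ').toFinset ∧
      (Function.support w).Finite ∧
      (∀ p : Sites₀ t A, dist (p : EuclideanSpace ℝ (Fin 3)) c₀ ≤ ρ' → 𝕃 (fun x => v x + w x) @ p = 0) ∧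
      nnForm t A w ≤ 2 * (((Real.sqrt (∑ x ∈ (finite_sites_dist_le (t := t) (A := A) hA hI c₀ ρ').toFinset, ‖φ x‖ ^ 2) +
        Λ * (3 * (1024 / ((23 / 25 : ℝ) ^ 3 * L ^ 5)) * Real.sqrt (∑ x ∈ SR.filter (fun p => dist p c₀ ≤ ρ'), ‖vt x‖ ^ 2) +
          Real.sqrt (1024 / ((23 / 25 : ℝ) ^ 3 * L ^ 5)) * Real.sqrt
            ((1024 / ((23 / 25 : ℝ) ^ 3 * L ^ 5)) * (∑ q ∈ SR.filter (fun q => dist q c₀ ≤ 2 * ρ'), ‖vt q‖ ^ 2) +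
              8192 * ρ' ^ 3 * ∑ q ∈ SR.filter (fun q => ¬ dist q c₀ ≤ 2 * ρ'), (dist q c₀)⁻¹ ^ 8 * ‖vt q‖ ^ 2))) *
          (400 * ρ' / 189 + 2)) ^ 2 +
        (4000000 * Λ * Real.sqrt (NN[v, ρ' + 10 * L + 20])) ^ 2) / κ ^ 2 ∧
      ∑' p : Sites₀ t A, ‖w p‖ ^ 2 ≤ (400 * ρ' / 189 + 2) ^ 2 * nnForm t A w := by
  have hL0 : 0 ≤ 10 * L + 20 := by linarith
  set F := (finite_sites_dist_le (t := t) (A := A) hA hI c₀ ρ').toFinset with hFdef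
  have hmemF : ∀ x, x ∈ F ↔ x ∈ Sites₀ t A ∧ dist x c₀ ≤ ρ' := fun x => by
    rw [hFdef, Set.Finite.mem_toFinset]; rfl
  have hF : ∀ x ∈ F, x ∈ Sites₀ t A := fun x hx => ((hmemF x).1 hx).1
  have hFSR : F ⊆ SR := fun x hx => hSRball x (hF x hx) (by linarith [((hmemF x).1 hx).2])
  -- the Dirichlet correction
  obtain ⟨w, hwF, hw0⟩ := exists_dirichlet_correction hA hI hκ0 hκ hF hv (fun _ => (0 : EuclideanSpace ℝ (Fin 3)))
  have hwfin : (Function.support w).Finite := Set.Finite.subset F.finite_toSet hwF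
  refine ⟨w, hwF, hwfin, fun p hp => hw0 p ((hmemF p).2 ⟨p.2, hp⟩), ?_, ?_⟩
  · -- rows of w on F
    have hroww : ∀ p : Sites₀ t A, (p : EuclideanSpace ℝ (Fin 3)) ∈ F →
        𝕃 w @ p = (fun s => -φ s) p + ∑ q ∈ SR.erase p, (fun s q => -Φ s q) p q := by
      simp only []
      intro p hp
      obtain ⟨hpS, hpd⟩ := (hmemF p).1 hp
      have hv_row := hrow p (hFSR hp) (by linarith)
      have hadd := opRow_add_field hA hI hv hwfin p
      have h0 := hw0 p hp
      rw [hadd, hv_row] at h0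
      have : 𝕃 w @ p = -(φ p + ∑ q ∈ SR.erase p, Φ p q) := eq_neg_of_add_eq_zero_right h0
      rw [this, neg_add, ← Finset.sum_neg_distrib]
    have hanti' : ∀ p ∈ SR, ∀ q ∈ SR, (fun s q => -Φ s q) q p = -(fun s q => -Φ s q) p q := by
      intro p hp q hq
      simp only []
      rw [hanti p hp q hq]
    have hΦ' : ∀ p ∈ SR, ∀ q ∈ SR, p ≠ q → ‖(fun s q => -Φ s q) p q‖ ≤ Λ * (dist p q)⁻¹ ^ 8 * ‖vt p - vt q‖ := by
      intro p hp q hq hpq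
      simp only [norm_neg]
      exact hΦ p hp q hq hpq
    -- far flux data at (ρ', L)
    have hΘ := far_flux_sq_le hA hI vt SR hSRS c₀ (b := ρ') hρ' le_rfl hL
    have hE := nnForm_correction_le' hA hI hκ0 hκ hwfin F SR (fun x hx => hwF hx) hFSR hSRS (fun s => -φ s) (fun s q => -Φ s q)
      hroww hanti' hρ'
      (fun x hx => ((hmemF x).1 hx).2) hΛ hL hΦ' hΘ (c₀ := c₀)
    -- convert: ‖-φ‖ = ‖φ‖ and NN[ṽ] = NN[v] on the ball
    have hsum : ∑ x ∈ F, ‖(fun s => -φ s) x‖ ^ 2 = ∑ x ∈ F, ‖φ x‖ ^ 2 :=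
      Finset.sum_congr rfl fun x _ => by simp only [norm_neg]
    have hNN : NN[vt, ρ' + 10 * L + 20] = NN[v, ρ' + 10 * L + 20] := NN_congr hA hI hvt
    rw [hsum, hNN] at hE
    exact hE
  · -- Poincaré
    have hwR : Function.support w ⊆ Metric.closedBall c₀ ρ' := by
      intro x hx
      have := ((hmemF x).1 (hwF hx)).2
      rw [Metric.mem_closedBall]; exact this
    exact tsum_norm_sq_le_mul_nnForm hA hI hwfin (by linarith) hwR

end

end Summit.AtomisticToContinuum.Crystallization.Theorems.ExcessDecayLiouville

end
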